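import Mathlib
import HarnessLib
import Literature.MathematicalPhysics.QuantumLattice.KohnLuttingerFermiCurvePolar
import Literature.MathematicalPhysics.QuantumLattice.HubbardBandSectorCountingToolbox
import Literature.MathematicalPhysics.QuantumLattice.HubbardPairEnergyNondegenerate

/-!
# Route `KLProgramme` (cruxes K3 `KLRegimeTwoPointLimit`, K1 `H10TwoPointLimit`): the Fermi-surface
# hypotheses A2–A4 of FST II for the Hubbard band, with CLOSED-FORM constants

Cell `gate-hubbard-kl`, risk-register item r2 «Fermi-surface hypotheses at `δ ∈ [0.10, 0.20]`» (human
ruling D-0069 (2)). Everything is stated in the `μ`-parametrisation for the free band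
`ε(k) = -2 (cos k₁ + cos k₂)` (`sqDispersion`, `squareDispersion 1 0`, the polar band curve `bandX/bandY` of
`HubbardFermiBandCurvature`), so nothing here depends on the `δ ↔ μ` dictionary (support item
`MuOfDopingWindow`). On the level set `cos x + cos y = m`, `m = -μ/2 ∈ (0, 2)` (`-4 < μ < 0`), with
`a = cos x`, `b = cos y`, `S = sin² x + sin² y = 2 - a² - b²`, one has `m - 1 ≤ ab ≤ m²/4` (§0), hence the
envelopes below; all four extremes are ATTAINED (antinode `(K(μ), 0)`, `K = umklappRadius`; node `x = y`):

* §1 (FST II hypothesis A2 «`∇e ≠ 0` on `S`», quantitative) **Fermi velocity**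
  `-μ (4 + μ) ≤ ‖∇ε‖² = 4 S ≤ 8 - μ²/2` (`klfs_fermiSpeedSq_mem_Icc`, `klfs_sqrt_le_norm_gradient`);
* §2 (A3 «`κ > 0`», quantitative) **curvature envelope** for the intrinsic curvature of the level curve
  `κ = (ε_xx ε_y² - 2ε_xy ε_x ε_y + ε_yy ε_x²)/‖∇ε‖³ = (cos x sin² y + cos y sin² x)/S^{3/2}`:
  `-μ/√(32 - 2μ²) ≤ κ ≤ 2/√(-μ (4 + μ))` (`klfs_curvature_mem_Icc`) — `κ` is the antitone function
  `m (4 - m² - S)/(2 S √S)` of `S` alone, minimal at the node, maximal at the antinode;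
* §2b the polar-parametrisation curvature `(x'y'' - y'x'')/|p'|³` of the tree's band curve IS that `κ`
  (`klfs_polarCurvature_eq_intrinsic`), so `bandHess_pos` / `BandBounds.hess_ge` and FST's A3 coincide, and
  the envelope holds along the band curve (`klfs_polarCurvature_mem_Icc`);
* §3 (A4) `ε` is even.

A5 (the filling restriction) and the umklapp corners are in `KLProgrammeFermiSurfaceUmklapp.lean`; the
numbers on the windows `μ ∈ [-0.4267, -0.1798]` / `[-1, -0.15]` and the nesting defect in
`KLProgrammeFermiSurfaceWindow.lean`. FST II = Feldman–Salmhofer–Trubowitz, CPAM 51 (1998) 1133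
(arXiv:cond-mat/9701073), §1 p.7 (hypotheses A1–A5). No definitions; everything PROVED. [folklore]
-/

noncomputable section

open Real Set

-- the tree's namespace `Summit.<Summit>.<Problem>.Theorems` repeats the summit name by design (D-0017)
set_option linter.dupNamespace false

namespace Summit.HubbardSuperconductivity.HubbardSuperconductivity.Theorems

open Literature.MathematicalPhysics.QuantumLattice

/-! ### §0 Algebra on the level set `cos x + cos y = m` -/

/-- On the level `a + b = m` with `a, b ≤ 1`: `m - 1 ≤ ab` (`(1 - a)(1 - b) ≥ 0`). [folklore] -/
theorem klfs_sub_one_le_mul {a b m : ℝ} (ha : a ≤ 1) (hb : b ≤ 1) (h : a + b = m) : m - 1 ≤ a * b := by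
  nlinarith [mul_nonneg (sub_nonneg.2 ha) (sub_nonneg.2 hb)]

/-- On the level `a + b = m`: `ab ≤ m²/4` (`(a - b)² ≥ 0`). [folklore] -/
theorem klfs_mul_le_sq_div_four {a b m : ℝ} (h : a + b = m) : a * b ≤ m ^ 2 / 4 := by
  rw [← h]; nlinarith [sq_nonneg (a - b)]

/-- **Lower edge of `S = 2 - a² - b²`** on the level: `m (2 - m) ≤ S` (equality at the antinode
`a = m - 1`, `b = 1`). [folklore] -/
theorem klfs_level_S_ge {a b m : ℝ} (ha : a ≤ 1) (hb : b ≤ 1) (h : a + b = m) :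
    m * (2 - m) ≤ (1 - a ^ 2) + (1 - b ^ 2) := by
  have := klfs_sub_one_le_mul ha hb h
  nlinarith

/-- **Upper edge of `S`** on the level: `S ≤ 2 - m²/2` (equality at the node `a = b = m/2`). [folklore] -/
theorem klfs_level_S_le {a b m : ℝ} (h : a + b = m) : (1 - a ^ 2) + (1 - b ^ 2) ≤ 2 - m ^ 2 / 2 := by
  rw [← h]; nlinarith [sq_nonneg (a - b)]

/-- The curvature numerator on the level: `a (1 - b²) + b (1 - a²) = m (4 - m² - S)/2`. [folklore] -/
theorem klfs_level_N_eq {a b m : ℝ} (h : a + b = m) :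
    a * (1 - b ^ 2) + b * (1 - a ^ 2) = m * (4 - m ^ 2 - ((1 - a ^ 2) + (1 - b ^ 2))) / 2 := by
  subst h; ring

/-- The model function `κ(S) = m (4 - m² - S) / (2 S √S)` is **antitone in `S`** on `0 < S ≤ 4 - m²`
(numerator positive and decreasing, denominator positive and increasing). [folklore] -/
theorem klfs_kappa_model_antitone {m S₁ S₂ : ℝ} (hm : 0 ≤ m) (hS₁ : 0 < S₁) (h12 : S₁ ≤ S₂)
    (hS₂ : S₂ ≤ 4 - m ^ 2) :
    m * (4 - m ^ 2 - S₂) / (2 * (S₂ * Real.sqrt S₂)) ≤ m * (4 - m ^ 2 - S₁) / (2 * (S₁ * Real.sqrt S₁)) := by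
  have hS₂pos : 0 < S₂ := hS₁.trans_le h12
  have hsq : Real.sqrt S₁ ≤ Real.sqrt S₂ := Real.sqrt_le_sqrt h12
  have hsq₁ : 0 < Real.sqrt S₁ := Real.sqrt_pos.2 hS₁
  have hden : S₁ * Real.sqrt S₁ ≤ S₂ * Real.sqrt S₂ := mul_le_mul h12 hsq hsq₁.le hS₂pos.le
  have hnum : m * (4 - m ^ 2 - S₂) ≤ m * (4 - m ^ 2 - S₁) := mul_le_mul_of_nonneg_left (by linarith) hm
  have hnum₂ : 0 ≤ m * (4 - m ^ 2 - S₂) := mul_nonneg hm (by linarith)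
  have hd₁ : 0 < 2 * (S₁ * Real.sqrt S₁) := by positivity
  exact div_le_div₀ (hnum₂.trans hnum) hnum hd₁ (by linarith)

/-- `κ` at the upper edge `S = 2 - m²/2`: the **nodal curvature** `m / (2 √(2 - m²/2))`. [folklore] -/
theorem klfs_kappa_model_node {m : ℝ} (hm2 : m ^ 2 < 4) :
    m * (4 - m ^ 2 - (2 - m ^ 2 / 2)) / (2 * ((2 - m ^ 2 / 2) * Real.sqrt (2 - m ^ 2 / 2))) =
      m / (2 * Real.sqrt (2 - m ^ 2 / 2)) := by
  have hS : 0 < 2 - m ^ 2 / 2 := by linarith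
  have hsq : 0 < Real.sqrt (2 - m ^ 2 / 2) := Real.sqrt_pos.2 hS
  rw [show 4 - m ^ 2 - (2 - m ^ 2 / 2) = 2 - m ^ 2 / 2 by ring,
    div_eq_div_iff (by positivity) (by positivity)]
  ring

/-- `κ` at the lower edge `S = m (2 - m)`: the **antinodal curvature** `1 / √(m (2 - m))`. [folklore] -/
theorem klfs_kappa_model_antinode {m : ℝ} (hm0 : 0 < m) (hm2 : m < 2) :
    m * (4 - m ^ 2 - m * (2 - m)) / (2 * ((m * (2 - m)) * Real.sqrt (m * (2 - m)))) =
      1 / Real.sqrt (m * (2 - m)) := by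
  have hS : 0 < m * (2 - m) := mul_pos hm0 (by linarith)
  have hsq : 0 < Real.sqrt (m * (2 - m)) := Real.sqrt_pos.2 hS
  rw [show 4 - m ^ 2 - m * (2 - m) = 2 * (2 - m) by ring,
    div_eq_div_iff (by positivity) (by positivity)]
  ring

/-! ### §1 (A2) The Fermi velocity on the level curve -/

/-- **Fermi-velocity envelope on the level curve `-2 (cos x + cos y) = μ`** (any real `x, y`):
`-μ (4 + μ) ≤ 4 (sin² x + sin² y) ≤ 8 - μ²/2`. The left end is attained at the antinode `(K(μ), 0)`,
the right end at the node `x = y`; for `-4 < μ < 0` the left end is positive, so `∇ε = 2 (sin x, sin y)`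
never vanishes on the Fermi curve (FST II hypothesis A2 for the Hubbard band, with its constant).
[folklore] -/
theorem klfs_fermiSpeedSq_mem_Icc {μ x y : ℝ} (h : -2 * (Real.cos x + Real.cos y) = μ) :
    4 * (Real.sin x ^ 2 + Real.sin y ^ 2) ∈ Icc (-μ * (4 + μ)) (8 - μ ^ 2 / 2) := by
  have hlev : Real.cos x + Real.cos y = -μ / 2 := by linarith
  have hsx : Real.sin x ^ 2 = 1 - Real.cos x ^ 2 := by rw [Real.sin_sq]
  have hsy : Real.sin y ^ 2 = 1 - Real.cos y ^ 2 := by rw [Real.sin_sq]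
  have h1 := klfs_level_S_ge (Real.cos_le_one x) (Real.cos_le_one y) hlev
  have h2 := klfs_level_S_le hlev
  rw [hsx, hsy]
  constructor <;> nlinarith [h1, h2]

/-- `2 √S = √(4 S)`. [folklore] -/
theorem klfs_two_mul_sqrt (S : ℝ) : 2 * Real.sqrt S = Real.sqrt (4 * S) := by
  rcases le_or_gt 0 S with hS | hS
  · rw [Real.sqrt_mul' 4 hS, show (4 : ℝ) = 2 ^ 2 by norm_num, Real.sqrt_sq (by norm_num : (0 : ℝ) ≤ 2)]
  · rw [Real.sqrt_eq_zero'.2 hS.le, Real.sqrt_eq_zero'.2 (by linarith), mul_zero]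

/-- **A2 for the Hubbard band, `KohnLuttinger` vocabulary**: on the Fermi curve of
`ε = squareDispersion 1 0` at level `μ`, `‖∇ε(k)‖ ≥ √(-μ (4 + μ))` (positive for `-4 < μ < 0`).
[folklore] -/
theorem klfs_sqrt_le_norm_gradient {μ : ℝ} {k : Momentum} (hk : k ∈ fermiCurve (squareDispersion 1 0) μ) :
    Real.sqrt (-μ * (4 + μ)) ≤ ‖gradient (squareDispersion 1 0) k‖ := by
  have he : -2 * (Real.cos (k 0) + Real.cos (k 1)) = μ := by
    have := hk.2; simp [squareDispersion] at this; linarith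
  have hI := klfs_fermiSpeedSq_mem_Icc he
  rw [norm_gradient_squareDispersion, klfs_two_mul_sqrt]
  exact Real.sqrt_le_sqrt hI.1

/-- The upper end in the same vocabulary: `‖∇ε(k)‖ ≤ √(8 - μ²/2)`. [folklore] -/
theorem klfs_norm_gradient_le_sqrt {μ : ℝ} {k : Momentum} (hk : k ∈ fermiCurve (squareDispersion 1 0) μ) :
    ‖gradient (squareDispersion 1 0) k‖ ≤ Real.sqrt (8 - μ ^ 2 / 2) := by
  have he : -2 * (Real.cos (k 0) + Real.cos (k 1)) = μ := by
    have := hk.2; simp [squareDispersion] at this; linarith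
  have hI := klfs_fermiSpeedSq_mem_Icc he
  rw [norm_gradient_squareDispersion, klfs_two_mul_sqrt]
  exact Real.sqrt_le_sqrt hI.2

/-- **A2, qualitative form**: `∇ε ≠ 0` on the Fermi curve for every level `-4 < μ < 0`. [folklore] -/
theorem klfs_gradient_ne_zero {μ : ℝ} (hμ₁ : -4 < μ) (hμ₂ : μ < 0) {k : Momentum}
    (hk : k ∈ fermiCurve (squareDispersion 1 0) μ) : gradient (squareDispersion 1 0) k ≠ 0 := by
  have hpos : 0 < Real.sqrt (-μ * (4 + μ)) := Real.sqrt_pos.2 (by nlinarith)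
  have h := klfs_sqrt_le_norm_gradient hk
  intro h0
  rw [h0, norm_zero] at h
  linarith

/-- The antinode realises the lower end: at `(x, y) = (K(μ), 0)`, `K(μ) = arccos (-μ/2 - 1)`
(`umklappRadius`), one has `-2 (cos x + cos y) = μ` and `4 (sin² x + sin² y) = -μ (4 + μ)`
(`-4 ≤ μ ≤ 0`). [folklore] -/
theorem klfs_fermiSpeedSq_antinode {μ : ℝ} (hμ₁ : -4 ≤ μ) (hμ₂ : μ ≤ 0) :
    -2 * (Real.cos (umklappRadius μ) + Real.cos 0) = μ ∧
      4 * (Real.sin (umklappRadius μ) ^ 2 + Real.sin 0 ^ 2) = -μ * (4 + μ) := by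
  have hc : Real.cos (umklappRadius μ) = -μ / 2 - 1 := by
    rw [umklappRadius, Real.cos_arccos (by linarith) (by linarith)]
  refine ⟨by rw [hc, Real.cos_zero]; ring, ?_⟩
  rw [Real.sin_zero, Real.sin_sq, hc]; ring

/-- The node realises the upper end: at `x = y = arccos (-μ/4)` one has `-2 (cos x + cos y) = μ` and
`4 (sin² x + sin² y) = 8 - μ²/2` (`-4 ≤ μ ≤ 4`). [folklore] -/
theorem klfs_fermiSpeedSq_node {μ : ℝ} (hμ₁ : -4 ≤ μ) (hμ₂ : μ ≤ 4) :
    -2 * (Real.cos (Real.arccos (-μ / 4)) + Real.cos (Real.arccos (-μ / 4))) = μ ∧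
      4 * (Real.sin (Real.arccos (-μ / 4)) ^ 2 + Real.sin (Real.arccos (-μ / 4)) ^ 2) = 8 - μ ^ 2 / 2 := by
  have hc : Real.cos (Real.arccos (-μ / 4)) = -μ / 4 := Real.cos_arccos (by linarith) (by linarith)
  refine ⟨by rw [hc]; ring, ?_⟩
  rw [Real.sin_sq, hc]; ring

/-! ### §2 (A3) The curvature envelope -/

/-- **Curvature envelope on the level curve `-2 (cos x + cos y) = μ`, `-4 < μ < 0`** (any real `x, y`):
the intrinsic curvature of the level curve of `ε` through `(x, y)`,
`κ = (ε_xx ε_y² - 2 ε_xy ε_x ε_y + ε_yy ε_x²)/‖∇ε‖³ = (cos x sin² y + cos y sin² x)/(sin² x + sin² y)^{3/2}`,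
satisfies `-μ / √(32 - 2μ²) ≤ κ ≤ 2 / √(-μ (4 + μ))`: it is the antitone function
`m (4 - m² - S)/(2 S √S)` (`m = -μ/2`) of `S = sin² x + sin² y ∈ [m (2 - m), 2 - m²/2]` alone, minimal
at the node and maximal at the antinode. In particular `κ > 0` everywhere (FST II hypothesis A3 —
strict convexity — for the Hubbard band at every filling below half filling, with its constants).
[folklore] -/
theorem klfs_curvature_mem_Icc {μ x y : ℝ} (hμ₁ : -4 < μ) (hμ₂ : μ < 0)
    (h : -2 * (Real.cos x + Real.cos y) = μ) :
    (Real.cos x * Real.sin y ^ 2 + Real.cos y * Real.sin x ^ 2) /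
        ((Real.sin x ^ 2 + Real.sin y ^ 2) * Real.sqrt (Real.sin x ^ 2 + Real.sin y ^ 2)) ∈
      Icc (-μ / Real.sqrt (32 - 2 * μ ^ 2)) (2 / Real.sqrt (-μ * (4 + μ))) := by
  set m : ℝ := -μ / 2 with hm
  have hm0 : 0 < m := by rw [hm]; linarith
  have hm2 : m < 2 := by rw [hm]; linarith
  have hmsq : m ^ 2 < 4 := by nlinarith
  have hlev : Real.cos x + Real.cos y = m := by rw [hm]; linarith
  set a := Real.cos x with ha
  set b := Real.cos y with hb
  have hsx : Real.sin x ^ 2 = 1 - a ^ 2 := by rw [Real.sin_sq]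
  have hsy : Real.sin y ^ 2 = 1 - b ^ 2 := by rw [Real.sin_sq]
  set S := Real.sin x ^ 2 + Real.sin y ^ 2 with hS
  have hSab : S = (1 - a ^ 2) + (1 - b ^ 2) := by rw [hS, hsx, hsy]
  have hSlo : m * (2 - m) ≤ S := by rw [hSab]; exact klfs_level_S_ge (Real.cos_le_one x) (Real.cos_le_one y) hlev
  have hShi : S ≤ 2 - m ^ 2 / 2 := by rw [hSab]; exact klfs_level_S_le hlev
  have hS0 : 0 < m * (2 - m) := mul_pos hm0 (by linarith)
  have hSpos : 0 < S := hS0.trans_le hSlo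
  -- the numerator in terms of `S`
  have hN : Real.cos x * Real.sin y ^ 2 + Real.cos y * Real.sin x ^ 2 = m * (4 - m ^ 2 - S) / 2 := by
    rw [hsx, hsy, hSab]; exact klfs_level_N_eq hlev
  have hκ : (Real.cos x * Real.sin y ^ 2 + Real.cos y * Real.sin x ^ 2) / (S * Real.sqrt S) =
      m * (4 - m ^ 2 - S) / (2 * (S * Real.sqrt S)) := by
    rw [hN]; field_simp
  rw [hκ]
  constructor
  · -- lower end: compare with the node value `S₁ = 2 - m²/2`
    have h1 := klfs_kappa_model_antitone hm0.le hSpos hShi (by nlinarith)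
    rw [klfs_kappa_model_node hmsq] at h1
    have heq : -μ / Real.sqrt (32 - 2 * μ ^ 2) = m / (2 * Real.sqrt (2 - m ^ 2 / 2)) := by
      have h32 : 32 - 2 * μ ^ 2 = 4 ^ 2 * (2 - m ^ 2 / 2) := by rw [hm]; ring
      have hsq : 0 < Real.sqrt (2 - m ^ 2 / 2) := Real.sqrt_pos.2 (by nlinarith)
      rw [h32, Real.sqrt_mul (by norm_num), Real.sqrt_sq (by norm_num),
        div_eq_div_iff (by positivity) (by positivity), hm]
      ring
    rw [heq]; exact h1
  · -- upper end: compare with the antinode value `S₀ = m (2 - m)`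
    have h1 := klfs_kappa_model_antitone hm0.le hS0 hSlo (by nlinarith)
    rw [klfs_kappa_model_antinode hm0 hm2] at h1
    have heq : 2 / Real.sqrt (-μ * (4 + μ)) = 1 / Real.sqrt (m * (2 - m)) := by
      have h4 : -μ * (4 + μ) = 2 ^ 2 * (m * (2 - m)) := by rw [hm]; ring
      rw [h4, Real.sqrt_mul (by norm_num), Real.sqrt_sq (by norm_num)]
      have : 0 < Real.sqrt (m * (2 - m)) := Real.sqrt_pos.2 hS0
      field_simp
    rw [heq]; exact h1

/-- **Strict convexity, qualitative**: on the level curve (`-4 < μ < 0`) the curvature numerator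
`cos x sin² y + cos y sin² x` is positive (it equals `(cos x + cos y)(1 - cos x cos y)`, cf. the tree's
`bandHess_pos`). [folklore] -/
theorem klfs_curvature_num_pos {μ x y : ℝ} (hμ₁ : -4 < μ) (hμ₂ : μ < 0)
    (h : -2 * (Real.cos x + Real.cos y) = μ) :
    0 < Real.cos x * Real.sin y ^ 2 + Real.cos y * Real.sin x ^ 2 := by
  have hlev : Real.cos x + Real.cos y = -μ / 2 := by linarith
  have key : Real.cos x * Real.sin y ^ 2 + Real.cos y * Real.sin x ^ 2 =
      (Real.cos x + Real.cos y) * (1 - Real.cos x * Real.cos y) := by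
    rw [Real.sin_sq, Real.sin_sq]; ring
  rw [key, hlev]
  exact mul_pos (by linarith) (one_sub_cos_mul_cos_pos (by linarith) (by linarith) hlev)

/-- The lower end of the curvature envelope is positive for `-4 < μ < 0`. [folklore] -/
theorem klfs_curvature_lower_pos {μ : ℝ} (hμ₁ : -4 < μ) (hμ₂ : μ < 0) :
    0 < -μ / Real.sqrt (32 - 2 * μ ^ 2) :=
  div_pos (by linarith) (Real.sqrt_pos.2 (by nlinarith))

/-- The node realises the lower end of the curvature envelope: at `x = y = arccos (-μ/4)`,
`κ = -μ / √(32 - 2μ²)` (`-4 < μ < 0`). [folklore] -/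
theorem klfs_curvature_node {μ : ℝ} (hμ₁ : -4 < μ) (hμ₂ : μ < 0) :
    (Real.cos (Real.arccos (-μ / 4)) * Real.sin (Real.arccos (-μ / 4)) ^ 2 +
          Real.cos (Real.arccos (-μ / 4)) * Real.sin (Real.arccos (-μ / 4)) ^ 2) /
        ((Real.sin (Real.arccos (-μ / 4)) ^ 2 + Real.sin (Real.arccos (-μ / 4)) ^ 2) *
          Real.sqrt (Real.sin (Real.arccos (-μ / 4)) ^ 2 + Real.sin (Real.arccos (-μ / 4)) ^ 2)) =
      -μ / Real.sqrt (32 - 2 * μ ^ 2) := by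
  have hc : Real.cos (Real.arccos (-μ / 4)) = -μ / 4 := Real.cos_arccos (by linarith) (by linarith)
  have hpos : 0 < 32 - 2 * μ ^ 2 := by nlinarith
  set s := Real.sqrt (32 - 2 * μ ^ 2) with hs_def
  have hs0 : 0 < s := Real.sqrt_pos.2 hpos
  have hs2 : s ^ 2 = 32 - 2 * μ ^ 2 := Real.sq_sqrt hpos.le
  have hsin : Real.sin (Real.arccos (-μ / 4)) ^ 2 = s ^ 2 / 32 := by rw [Real.sin_sq, hc, hs2]; ring
  have hT : s ^ 2 / 32 + s ^ 2 / 32 = (s / 4) ^ 2 := by ring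
  rw [hsin, hc, hT, Real.sqrt_sq (by positivity)]
  field_simp
  ring

/-- The antinode realises the upper end: at `(x, y) = (K(μ), 0)`, `κ = 2 / √(-μ (4 + μ))`
(`-4 < μ < 0`). [folklore] -/
theorem klfs_curvature_antinode {μ : ℝ} (hμ₁ : -4 < μ) (hμ₂ : μ < 0) :
    (Real.cos (umklappRadius μ) * Real.sin 0 ^ 2 + Real.cos 0 * Real.sin (umklappRadius μ) ^ 2) /
        ((Real.sin (umklappRadius μ) ^ 2 + Real.sin 0 ^ 2) *
          Real.sqrt (Real.sin (umklappRadius μ) ^ 2 + Real.sin 0 ^ 2)) =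
      2 / Real.sqrt (-μ * (4 + μ)) := by
  have hc : Real.cos (umklappRadius μ) = -μ / 2 - 1 := by
    rw [umklappRadius, Real.cos_arccos (by linarith) (by linarith)]
  have hpos : 0 < -μ * (4 + μ) := by nlinarith
  set s := Real.sqrt (-μ * (4 + μ)) with hs_def
  have hs0 : 0 < s := Real.sqrt_pos.2 hpos
  have hs2 : s ^ 2 = -μ * (4 + μ) := Real.sq_sqrt hpos.le
  have hsin : Real.sin (umklappRadius μ) ^ 2 = (s / 2) ^ 2 := by rw [Real.sin_sq, hc]; nlinarith [hs2]
  rw [Real.sin_zero, Real.cos_zero, hsin]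
  simp only [ne_eq, OfNat.ofNat_ne_zero, not_false_eq_true, zero_pow, mul_zero, zero_add, one_mul,
    add_zero]
  rw [Real.sqrt_sq (by positivity)]
  field_simp

/-! ### §2b The polar-parametrisation curvature of the tree's band curve is the intrinsic curvature -/

section Polar

variable {μ : ℝ} (hμ₁ : -4 < μ) (hμ₂ : μ < 0)
include hμ₁ hμ₂

/-- **The signed curvature `(x'y'' - y'x'')/|p'|³` of the tree's polar band curve
`θ ↦ (bandX μ θ, bandY μ θ)` (`HubbardFermiBandCurvature`) IS the intrinsic level-curve curvature**
`(cos x sin² y + cos y sin² x)/(sin² x + sin² y)^{3/2}` at its point: both equal `H/(c V √V)` with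
`H = cos x·x'² + cos y·y'²`, `V = x'² + y'²`, `c = bandNormalCoeff` (`sin x = c y'`, `sin y = -c x'`,
`c (x'y'' - y'x'') = H`). Hence `bandHess_pos`/`BandBounds.hess_ge` and FST's «`κ > 0`» (A3) are the same
statement. [folklore] -/
theorem klfs_polarCurvature_eq_intrinsic (θ : ℝ) :
    (bandVX μ θ * bandAY μ θ - bandVY μ θ * bandAX μ θ) /
        ((bandVX μ θ ^ 2 + bandVY μ θ ^ 2) * Real.sqrt (bandVX μ θ ^ 2 + bandVY μ θ ^ 2)) =
      (Real.cos (bandX μ θ) * Real.sin (bandY μ θ) ^ 2 + Real.cos (bandY μ θ) * Real.sin (bandX μ θ) ^ 2) /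
        ((Real.sin (bandX μ θ) ^ 2 + Real.sin (bandY μ θ) ^ 2) *
          Real.sqrt (Real.sin (bandX μ θ) ^ 2 + Real.sin (bandY μ θ) ^ 2)) := by
  have hc := bandNormalCoeff_pos hμ₁ hμ₂ θ
  have hV := bandVX_sq_add_bandVY_sq_pos hμ₁ hμ₂ θ
  have hcc := BandSectorCounting.bandNormalCoeff_mul_cross hμ₁ hμ₂ θ
  set c := bandNormalCoeff μ θ with hcdef
  set V := bandVX μ θ ^ 2 + bandVY μ θ ^ 2 with hVdef
  have hcross : bandVX μ θ * bandAY μ θ - bandVY μ θ * bandAX μ θ =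
      (Real.cos (bandX μ θ) * bandVX μ θ ^ 2 + Real.cos (bandY μ θ) * bandVY μ θ ^ 2) / c := by
    rw [eq_div_iff hc.ne']; linarith [hcc]
  have hS : Real.sin (bandX μ θ) ^ 2 + Real.sin (bandY μ θ) ^ 2 = c ^ 2 * V := by
    rw [sin_bandX_eq hμ₁ hμ₂, sin_bandY_eq hμ₁ hμ₂, hVdef]; ring
  have hN : Real.cos (bandX μ θ) * Real.sin (bandY μ θ) ^ 2 + Real.cos (bandY μ θ) * Real.sin (bandX μ θ) ^ 2 =
      c ^ 2 * (Real.cos (bandX μ θ) * bandVX μ θ ^ 2 + Real.cos (bandY μ θ) * bandVY μ θ ^ 2) := by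
    rw [sin_bandX_eq hμ₁ hμ₂, sin_bandY_eq hμ₁ hμ₂]; ring
  rw [hcross, hS, hN, Real.sqrt_mul' _ hV.le, Real.sqrt_sq hc.le]
  have hsq : 0 < Real.sqrt V := Real.sqrt_pos.2 hV
  field_simp

/-- **Curvature envelope along the band curve** (A3 with constants, polar form): for every angle,
`-μ/√(32 - 2μ²) ≤ (x'y'' - y'x'')/|p'|³ ≤ 2/√(-μ (4 + μ))`. [folklore] -/
theorem klfs_polarCurvature_mem_Icc (θ : ℝ) :
    (bandVX μ θ * bandAY μ θ - bandVY μ θ * bandAX μ θ) /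
        ((bandVX μ θ ^ 2 + bandVY μ θ ^ 2) * Real.sqrt (bandVX μ θ ^ 2 + bandVY μ θ ^ 2)) ∈
      Icc (-μ / Real.sqrt (32 - 2 * μ ^ 2)) (2 / Real.sqrt (-μ * (4 + μ))) := by
  rw [klfs_polarCurvature_eq_intrinsic hμ₁ hμ₂]
  exact klfs_curvature_mem_Icc hμ₁ hμ₂ (sqDispersion_bandXY hμ₁ hμ₂ θ)

/-- **Fermi velocity along the band curve** (A2 with constants, polar form):
`-μ (4 + μ) ≤ 4 (sin² x(θ) + sin² y(θ)) ≤ 8 - μ²/2`. [folklore] -/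
theorem klfs_polarFermiSpeedSq_mem_Icc (θ : ℝ) :
    4 * (Real.sin (bandX μ θ) ^ 2 + Real.sin (bandY μ θ) ^ 2) ∈ Icc (-μ * (4 + μ)) (8 - μ ^ 2 / 2) :=
  klfs_fermiSpeedSq_mem_Icc (sqDispersion_bandXY hμ₁ hμ₂ θ)

end Polar

/-! ### §3 (A4) The band is symmetric -/

/-- **A4 for the Hubbard band**: `ε(-k) = ε(k)` (`Fin 2 → ℝ` vocabulary). [folklore] -/
theorem klfs_sqDispersion_neg (k : Fin 2 → ℝ) : sqDispersion (-k) = sqDispersion k := by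
  simp [sqDispersion, Real.cos_neg]

/-- **A4 for the Hubbard band**: `ε(-k) = ε(k)` (`Momentum` vocabulary, any `t, t'`). [folklore] -/
theorem klfs_squareDispersion_neg (t t' : ℝ) (k : Momentum) :
    squareDispersion t t' (-k) = squareDispersion t t' k := by
  simp [squareDispersion, Real.cos_neg]

/-- The Fermi curve is centrally symmetric: `k ∈ F_μ ↔ -k ∈ F_μ` up to the half-open boundary
convention of `brillouinZone`; precisely, for `k` in the OPEN cell, `-k ∈ fermiCurve ε μ`. [folklore] -/
theorem klfs_neg_mem_fermiCurve {μ : ℝ} {k : Momentum} (hk : k ∈ fermiCurve (squareDispersion 1 0) μ)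
    (hopen : ∀ i, k i ∈ Ioo (-π) π) : -k ∈ fermiCurve (squareDispersion 1 0) μ := by
  refine ⟨fun i => ?_, by rw [klfs_squareDispersion_neg]; exact hk.2⟩
  have h := hopen i
  simp only [WithLp.ofLp_neg, Pi.neg_apply, mem_Ico]
  constructor <;> linarith [h.1, h.2]

end Summit.HubbardSuperconductivity.HubbardSuperconductivity.Theorems

end
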